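import Summits.BirchSwinnertonDyer.BirchSwinnertonDyer.Theorems.ResidualThetaTransportAtTwoSignedMuSeedAtTwoPlusTiltFormalGroup
import Literature.NumberTheory.GaloisRepresentations.LubinTate
import Literature.NumberTheory.EllipticCurves.FormalGroupLawAxiomsUniversalProofs
import HarnessLib

/-!
# Seed crux `SignedMuSeedAtTwoPlus` (stmt-BirchSwinnertonDyer-21438), line `norm-field-tilt`:
# item (c) of stub S2 in Lubin–Tate generality — `[1 + πʲw] t = t ⊕ ([w]t)^{qʲ}` modulo `π`

Cell `bsd-wall`, width seat `bsd-wall-rtt-p4-w2` g10; sixth file on the line, on top of p657707 (`…TiltFormalGroup`: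
the CLAIM of S2 for the chord–tangent law of a Weierstrass curve, with a translation `y`, `y' = 0`).  HONEST FRAMING:
THEOREMS ONLY; closes no item; the line is NOT registered; BSD is NOT proved by this.

Item (c) of the card: «`h_m := g^{2^m}` satisfies `h_m − 1 ∈ 2^{m+1}ℤ₄^×`, `[h_m]t̄ = t̄ ⊕ y_m` with
`y_m = ([±v_m]t̄)^{4^{m+1}} ∈ 𝔽₄⟦t̄⟧^{4^{m+1}}` (because `[−2] = Frob₄` on this curve), `v(y_m) = 4^{m+1}`».  This is
Lubin–Tate theory reduced modulo `π`, and the tree has Lubin–Tate theory (`Literature/…/LubinTate.lean`: `IsLTRing π q`,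
`IsLTSeries π q f`, the formal `A`-module `[a] = LubinTate.hom`, `[π] = f`, `[1] = X`, `[a]∘[b] = [ab]`,
`[a + b] = F([a],[b])`, `f ≡ X^q (mod π)`; the relative case `(π, q) = (−p, p²)` of the RTT files
`…RelativeLubinTate*` is the line's `(−2, 4)`).  Writing `‾` for reduction modulo `π` (`A → A/π`), we prove for every
Lubin–Tate datum `(A, π, q, f)`:

* `map_hom_self` — `[π]‾ = X^q` ("`[−2] = Frob₄`"); `map_hom_pow` — `[πʲ]‾ = X^{qʲ}`;
* `map_hom_pow_mul` — `[πʲ·w]‾ = ([w]‾)^{qʲ}` (a `qʲ`-th power);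
* **`map_hom_one_add_pow_mul`** — `[1 + πʲ·w]‾ = F̄(X, ([w]‾)^{qʲ})`: reduced modulo `π`, the endomorphism `[h]` for
  `h ≡ 1 (mod πʲ)` IS the translation `t ↦ t ⊕ y` by `y = ([w]‾ t)^{qʲ}` of p657707 — item (c);
* `derivative_pow_map_hom_eq_zero` — `y' = 0` for such `y` (`q` is `0` in `A/π`), `constantCoeff_pow_map_hom` — `y(0) = 0`,
  and `order_pow_map_hom` — over a domain `A/π` with `w ∉ (π)`, `ord y = qʲ`;
* the bridge `map_hom_one_add_pow_mul_formalGroupLaw` — if `F = U.formalGroupLaw` for a Weierstrass model `U/A` (the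
  RTT files' `formalGroupLaw_eq_ltF'`), then `[1 + πʲw]‾ = (t ⊕ y)` computed with the chord–tangent law of `U ⊗ A/π`
  in the argument order `F̄(y, t)` of p657707 (commutativity `formalGroupLaw_comm'`).

So at level `m` of the line (`π = −2`, `q = 4`, `j = m + 1`, `h_m = 1 + (−2)^{m+1}w`): the hypotheses `y(0) = 0`,
`y' = 0`, `ord y = 4^{m+1}` of `tiltRecursion_step_formalGroupLaw` hold for `y_m = ([w]‾ t̄)^{4^{m+1}}`, and
`[h_m]‾ = t̄ ⊕ y_m`.  Not here: `Z'_{ρ,m}` itself (Robert's function), its membership and valuation (stub S1). [folklore]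
-/

noncomputable section

set_option autoImplicit false
set_option linter.dupNamespace false

open PowerSeries
open Literature.NumberTheory.GaloisRepresentations

namespace Summit.BirchSwinnertonDyer.BirchSwinnertonDyer.Theorems.SignedMuAtTwo.Tilt

variable {A : Type*} [CommRing A] {π : A} {q : ℕ} (hA : LubinTate.IsLTRing π q) {f : PowerSeries A}
  (hf : LubinTate.IsLTSeries π q f)

/-! ## Two bookkeeping lemmas on `PowerSeries.map` -/

omit hA in
/-- `PowerSeries.map` of a one-variable substitution (Mathlib's `PowerSeries.map_subst`, `PowerSeries`-typed).
[folklore] -/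
theorem map_subst' {R S : Type*} [CommRing R] [CommRing S] (h : R →+* S) {a : PowerSeries R} (ha : HasSubst a)
    (g : PowerSeries R) :
    PowerSeries.map h (g.subst a) = (PowerSeries.map h g).subst (PowerSeries.map h a) :=
  PowerSeries.map_subst ha g

omit hA in
/-- Constant coefficient of `PowerSeries.map`. [folklore] -/
theorem constantCoeff_map' {R S : Type*} [CommRing R] [CommRing S] (h : R →+* S) (g : PowerSeries R) :
    constantCoeff (PowerSeries.map h g) = h (constantCoeff g) := by
  rw [← coeff_zero_eq_constantCoeff_apply, PowerSeries.coeff_map, coeff_zero_eq_constantCoeff_apply]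

/-! ## Reduction of the Lubin–Tate endomorphisms modulo `π` -/

/-- **`[π]‾ = X^q`** (`[π]_f = f ≡ X^q (mod π)`; in the line `[−2] = Frob₄`). [folklore] -/
theorem map_hom_self :
    (LubinTate.hom hA hf hf π).map (Ideal.Quotient.mk (Ideal.span {π})) = X ^ q := by
  rw [LubinTate.hom_self_eq]; exact hf.map_mk

include hA hf in
/-- `[πʲ]‾ = X^{qʲ}`. [folklore] -/
theorem map_hom_pow (j : ℕ) :
    (LubinTate.hom hA hf hf (π ^ j)).map (Ideal.Quotient.mk (Ideal.span {π})) = X ^ (q ^ j) := by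
  induction j with
  | zero => rw [pow_zero, pow_zero, pow_one, LubinTate.hom_one, PowerSeries.map_X]
  | succ j ih =>
    have h0 := LubinTate.constantCoeff_hom hA hf hf π
    rw [pow_succ, ← LubinTate.hom_comp_hom hA hf hf hf (π ^ j) π,
      map_subst' _ (HasSubst.of_constantCoeff_zero' h0), ih]
    have hs : HasSubst ((LubinTate.hom hA hf hf π).map (Ideal.Quotient.mk (Ideal.span {π}))) :=
      HasSubst.of_constantCoeff_zero' (by rw [constantCoeff_map', h0, map_zero])
    rw [subst_pow hs, subst_X hs, map_hom_self, ← pow_mul, ← pow_succ']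

/-- **`[πʲ·w]‾ = ([w]‾)^{qʲ}`** — a `qʲ`-th power (`[πʲw] = [πʲ]∘[w]`). [folklore] -/
theorem map_hom_pow_mul (j : ℕ) (w : A) :
    (LubinTate.hom hA hf hf (π ^ j * w)).map (Ideal.Quotient.mk (Ideal.span {π})) =
      ((LubinTate.hom hA hf hf w).map (Ideal.Quotient.mk (Ideal.span {π}))) ^ (q ^ j) := by
  have h0 := LubinTate.constantCoeff_hom hA hf hf w
  have hs : HasSubst ((LubinTate.hom hA hf hf w).map (Ideal.Quotient.mk (Ideal.span {π}))) :=
    HasSubst.of_constantCoeff_zero' (by rw [constantCoeff_map', h0, map_zero])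
  rw [← LubinTate.hom_comp_hom hA hf hf hf (π ^ j) w,
    map_subst' _ (HasSubst.of_constantCoeff_zero' h0), map_hom_pow hA hf j, subst_pow hs, subst_X hs]

/-- **Item (c) of stub S2, Lubin–Tate form: `[1 + πʲ·w]‾ = F̄(X, ([w]‾)^{qʲ})`** — modulo `π` the endomorphism `[h]`,
`h = 1 + πʲw`, is the translation by the `qʲ`-th power `y = ([w]‾ X)^{qʲ}` (`[1 + b] = F([1], [b])`, `[1] = X`).
In the line: `h_m = g^{2^m} = 1 + (−2)^{m+1}·w`, `[h_m]t̄ = t̄ ⊕ y_m`, `y_m = ([w]t̄)^{4^{m+1}}`. [folklore] -/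
theorem map_hom_one_add_pow_mul (j : ℕ) (w : A) :
    (LubinTate.hom hA hf hf (1 + π ^ j * w)).map (Ideal.Quotient.mk (Ideal.span {π})) =
      MvPowerSeries.subst ![(X : PowerSeries (A ⧸ Ideal.span {π})),
          ((LubinTate.hom hA hf hf w).map (Ideal.Quotient.mk (Ideal.span {π}))) ^ (q ^ j)]
        ((LubinTate.ltF hA hf).map (Ideal.Quotient.mk (Ideal.span {π}))) := by
  have hb0 := LubinTate.constantCoeff_hom' hA hf hf (π ^ j * w)
  have hs : MvPowerSeries.HasSubst ![LubinTate.hom hA hf hf 1, LubinTate.hom hA hf hf (π ^ j * w)] :=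
    MvPowerSeries.hasSubst_of_constantCoeff_zero fun i => by
      fin_cases i
      · exact LubinTate.constantCoeff_hom' hA hf hf 1
      · exact hb0
  rw [LubinTate.hom_add]
  change MvPowerSeries.map _ (MvPowerSeries.subst _ _) = _
  rw [MvPowerSeries.map_subst hs]
  congr 1
  funext i
  fin_cases i
  · change PowerSeries.map _ (LubinTate.hom hA hf hf 1) = X
    rw [LubinTate.hom_one, PowerSeries.map_X]
  · exact map_hom_pow_mul hA hf j w

/-! ## The translation parameter `y = ([w]‾)^{qʲ}`: `y(0) = 0`, `y' = 0`, `ord y = qʲ` -/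

/-- `y(0) = 0` for `y = ([w]‾)^{qʲ}`. [folklore] -/
theorem constantCoeff_pow_map_hom (j : ℕ) (w : A) :
    constantCoeff (((LubinTate.hom hA hf hf w).map (Ideal.Quotient.mk (Ideal.span {π}))) ^ (q ^ j)) = 0 := by
  have hq : q ^ j ≠ 0 := by
    obtain ⟨p, r, hp, rfl, -⟩ := hA.exists_prime
    exact pow_ne_zero _ (pow_ne_zero _ hp.ne_zero)
  rw [map_pow, constantCoeff_map', LubinTate.constantCoeff_hom, map_zero, zero_pow hq]

include hA hf in
/-- `q = 0` in `A/π`: `q = pʳ` with `p ∈ (π)`; if `r = 0` then `q = 1` and `f ≡ πX (mod deg 2)`, `f ≡ X (mod π)` force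
`π ∣ 1`, i.e. `A/π = 0`. [folklore] -/
theorem natCast_q_eq_zero : ((q : ℕ) : A ⧸ Ideal.span {π}) = 0 := by
  obtain ⟨p, r, hp, rfl, hpmem⟩ := hA.exists_prime
  have hp0 : ((p : ℕ) : A ⧸ Ideal.span {π}) = 0 := by
    rw [show ((p : ℕ) : A ⧸ Ideal.span {π}) = Ideal.Quotient.mk (Ideal.span {π}) (p : A) by simp,
      Ideal.Quotient.eq_zero_iff_mem]
    exact hpmem
  rcases Nat.eq_zero_or_pos r with hr | hr
  · -- `q = 1`: the quotient ring is trivial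
    subst hr
    have h1 := hf.dvd_coeff_sub 1
    rw [hf.coeff_one, pow_zero, if_pos rfl] at h1
    have hone : (π : A) ∣ 1 := by
      have : (1 : A) = π - (π - 1) := by ring
      rw [this]; exact dvd_sub (dvd_refl π) h1
    have htriv : (1 : A ⧸ Ideal.span {π}) = 0 := by
      rw [← map_one (Ideal.Quotient.mk (Ideal.span {π})), Ideal.Quotient.eq_zero_iff_mem,
        Ideal.mem_span_singleton]
      exact hone
    rw [pow_zero, Nat.cast_one, htriv]
  · rw [Nat.cast_pow, hp0, zero_pow (by omega)]

/-- **`y' = 0`** for `y = ([w]‾)^{qʲ}`, `j ≥ 1` (`(g^{qʲ})' = qʲ·g^{qʲ−1}·g'` and `q = 0` in `A/π`). [folklore] -/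
theorem derivative_pow_map_hom_eq_zero {j : ℕ} (hj : 1 ≤ j) (w : A) :
    d⁄dX (A ⧸ Ideal.span {π})
      (((LubinTate.hom hA hf hf w).map (Ideal.Quotient.mk (Ideal.span {π}))) ^ (q ^ j)) = 0 := by
  rw [derivative_pow]
  have hq : ((q ^ j : ℕ) : PowerSeries (A ⧸ Ideal.span {π})) = 0 := by
    rw [← map_natCast (C (R := A ⧸ Ideal.span {π})), Nat.cast_pow, natCast_q_eq_zero hA hf,
      zero_pow (by omega), map_zero]
  rw [hq, zero_mul, zero_mul]

/-- **`ord y = qʲ`** for `y = ([w]‾)^{qʲ}` over a domain `A/π` when `w ∉ (π)` (`[w] ≡ wX (mod deg 2)`). [folklore] -/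
theorem order_pow_map_hom [IsDomain (A ⧸ Ideal.span {π})] (j : ℕ) {w : A} (hw : w ∉ Ideal.span {π}) :
    (((LubinTate.hom hA hf hf w).map (Ideal.Quotient.mk (Ideal.span {π}))) ^ (q ^ j)).order = (q ^ j : ℕ) := by
  have h1 : ((LubinTate.hom hA hf hf w).map (Ideal.Quotient.mk (Ideal.span {π}))).order = 1 := by
    apply le_antisymm
    · apply order_le
      rw [PowerSeries.coeff_map, LubinTate.coeff_one_hom]
      exact fun h => hw ((Ideal.Quotient.eq_zero_iff_mem).mp h)
    · refine nat_le_order _ _ fun i hi => ?_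
      rw [Nat.lt_one_iff.mp hi, PowerSeries.coeff_map, coeff_zero_eq_constantCoeff_apply,
        LubinTate.constantCoeff_hom, map_zero]
  rw [order_pow, h1]
  simp

/-! ## Bridge to the chord–tangent law of a Weierstrass model -/

/-- **Item (c) for a Weierstrass model.**  If `F = U.formalGroupLaw` for a Weierstrass equation `U/A` whose formal
group law IS the Lubin–Tate law of `f` (the RTT files' `formalGroupLaw_eq_ltF'`), then modulo `π`
`[1 + πʲ·w]‾ = t ⊕ y := F̄(y, t)` with `F̄` the chord–tangent law of `U ⊗ A/π` and `y = ([w]‾)^{qʲ}` — the translation of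
p657707, in its argument order. [folklore] -/
theorem map_hom_one_add_pow_mul_formalGroupLaw (U : WeierstrassCurve A) (hU : U.formalGroupLaw = LubinTate.ltF hA hf)
    (j : ℕ) (w : A) :
    (LubinTate.hom hA hf hf (1 + π ^ j * w)).map (Ideal.Quotient.mk (Ideal.span {π})) =
      MvPowerSeries.subst ![((LubinTate.hom hA hf hf w).map (Ideal.Quotient.mk (Ideal.span {π}))) ^ (q ^ j),
          (X : PowerSeries (A ⧸ Ideal.span {π}))]
        (U.map (Ideal.Quotient.mk (Ideal.span {π}))).formalGroupLaw := by
  set y := ((LubinTate.hom hA hf hf w).map (Ideal.Quotient.mk (Ideal.span {π}))) ^ (q ^ j) with hy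
  have hy0 : constantCoeff y = 0 := constantCoeff_pow_map_hom hA hf j w
  rw [map_hom_one_add_pow_mul hA hf j w, ← hU, WeierstrassCurve.map_formalGroupLaw]
  -- swap the arguments by commutativity of the chord–tangent law
  set W := U.map (Ideal.Quotient.mk (Ideal.span {π})) with hW
  have hsXy : MvPowerSeries.HasSubst ![(X : PowerSeries (A ⧸ Ideal.span {π})), y] :=
    MvPowerSeries.hasSubst_of_constantCoeff_zero fun i => by
      fin_cases i
      · exact PowerSeries.constantCoeff_X
      · exact hy0
  conv_lhs => rw [← W.formalGroupLaw_comm']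
  rw [MvPowerSeries.subst_comp_subst_apply
    (WeierstrassCurve.hasSubst_X_pair (R := A ⧸ Ideal.span {π}) 1 0) hsXy]
  congr 1
  funext i
  fin_cases i
  · exact MvPowerSeries.subst_X hsXy 1
  · exact MvPowerSeries.subst_X hsXy 0

end Summit.BirchSwinnertonDyer.BirchSwinnertonDyer.Theorems.SignedMuAtTwo.Tilt

end
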